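import Mathlib
import Literature.MathematicalPhysics.StatisticalMechanics.TransferLevelValue
import HarnessLib

/-!
# Crux `PatternPricedCertificates` (stmt-AtomisticToContinuum-12974), line `registered` (birth skeleton) —
# stub `stub_lensLift`: the lens lift (finite-volume mass transport)

This file discharges the registered stub `stub_lensLift` of line `registered` (skeleton
`Cruxes/PatternPricedCertificates/Lines/birth.lean`) for crux stmt-AtomisticToContinuum-12974
(`Summit.AtomisticToContinuum.Crystallization.Theses.FrustrationRangeCertificates.PatternPricedCertificates`).

**Statement.** Fix `0 < δ`, `0 ≤ r ≤ L`, a functional `F` of one rooted pattern and a rule `g (v, p, q)`.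
Suppose the pattern-pointwise bound `F S ≤ T_g(S)` holds for every `(δ, L)`-admissible rooted pattern
`S` (`IsRootedPattern δ L S`), where
`T_g(S) = Σ_{v ∈ lens r L S} [g(v, B_r S, B_r(reroot S v)) − g(−v, B_r(reroot S v), B_r S)]`
is the integrand of the finite-level mass-transport identity of
`Literature.Probability.PointProcesses.LensConsistentLaw`. Then at every particle `i` of every
finite `δ`-separated configuration `x` of `ℝ³`,
`F (relPattern L x i) ≤ Σ_{j ≠ i} [Φ(x_j − x_i, P_L i, P_L j) − Φ(x_i − x_j, P_L j, P_L i)]`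
for the lifted rule `Φ (v, p, q) := 1[‖v‖ ≤ L − r] · g (v, ballPattern r p, ballPattern r q)` and
`P_L k := relPattern L x k` — the route's unbounded-range transfer balance.

**Proof (folklore; the Aldous–Lyons "lens" in finite volume).**
* `isRootedPattern_relPattern`: the `L`-pattern `relPattern L x i` of a particle of a `δ`-separated
  configuration is `(δ, L)`-admissible (norms are distances to `x i`, differences are distances
  between the other particles).
* `ballPattern_reroot_relPattern`: for a neighbour `j` with `‖x_j − x_i‖ ≤ L − r`, the `r`-pattern of
  `j` is the `L`-pattern of `i` re-rooted at `x_j − x_i` and cut to the `r`-ball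
  (`B_r(x_j) ⊆ B_L(x_i)` by the triangle inequality; separated configurations are injective).
* `lens_relPattern`: the lens range of `relPattern L x i` is the image of `k ↦ x_k − x_i` over the
  particles `k ≠ i` with `‖x_k − x_i‖ ≤ L − r`; summing over the image (`Finset.sum_image`,
  injectivity) and inserting the indicator (`Finset.sum_filter`) gives the configuration balance
  term by term (`ballPattern_relPattern` identifies `ballPattern r (relPattern L x j)` with
  `relPattern r x j`).

No new definitions; nothing is assumed. [folklore]
-/

noncomputable section

open scoped BigOperators Classical

namespace Summit.AtomisticToContinuum.Crystallization.Theorems.PatternPricedCertificates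

open Literature.Probability.PointProcesses (IsRootedPattern ballPattern lens reroot)
open Literature.MathematicalPhysics.StatisticalMechanics (relPattern ballPattern_relPattern)

section Helpers

variable {E : Type*} [NormedAddCommGroup E] {N : ℕ}

/-- Separated configurations (pairwise distances `≥ δ > 0`) are injective. [folklore] -/
theorem lensLift_injective_of_separated {δ : ℝ} (hδ : 0 < δ) {x : Fin N → E}
    (hx : ∀ i j : Fin N, i ≠ j → δ ≤ dist (x i) (x j)) : Function.Injective x := by
  intro k l hkl
  by_contra hne
  have h := hx k l hne
  rw [hkl, dist_self] at h
  exact absurd h (not_le.2 hδ)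

variable [DecidableEq E]

/-- The `L`-pattern `relPattern L x i` of a particle of a `δ`-separated configuration is a
`(δ, L)`-admissible rooted pattern: every relative position `x k − x i` has norm
`dist (x i) (x k) ∈ [δ, L]`, and two of them differ by `x k − x l`, of norm `≥ δ`. [folklore] -/
theorem isRootedPattern_relPattern {δ : ℝ} (L : ℝ) {x : Fin N → E}
    (hx : ∀ i j : Fin N, i ≠ j → δ ≤ dist (x i) (x j)) (i : Fin N) :
    IsRootedPattern δ L (relPattern L x i) := by
  refine ⟨fun v hv => ?_, fun v hv w hw hvw => ?_⟩
  · obtain ⟨k, hk, rfl⟩ := Finset.mem_image.1 hv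
    simp only [Finset.mem_filter, Finset.mem_univ, true_and] at hk
    rw [← dist_eq_norm, dist_comm]
    exact ⟨hx i k (Ne.symm hk.1), hk.2⟩
  · obtain ⟨k, -, rfl⟩ := Finset.mem_image.1 hv
    obtain ⟨l, -, rfl⟩ := Finset.mem_image.1 hw
    have hkl : k ≠ l := fun h => hvw (by rw [h])
    rw [sub_sub_sub_cancel_right, ← dist_eq_norm]
    exact hx k l hkl

/-- **The lens.** For a neighbour `j` of `i` with `‖x j − x i‖ ≤ L − r` in a `δ`-separated
configuration, the `r`-pattern of `j` is the `L`-pattern of `i` re-rooted at `x j − x i` and cut to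
the closed `r`-ball: `ballPattern r (reroot (relPattern L x i) (x j − x i)) = relPattern r x j`
(`B_r(x_j) ⊆ B_L(x_i)` by the triangle inequality; the deleted new root is exactly `k = j` by
injectivity). [folklore] -/
theorem ballPattern_reroot_relPattern {δ r L : ℝ} (hδ : 0 < δ) {x : Fin N → E}
    (hx : ∀ i j : Fin N, i ≠ j → δ ≤ dist (x i) (x j)) {i j : Fin N}
    (hij : ‖x j - x i‖ ≤ L - r) :
    ballPattern r (reroot (relPattern L x i) (x j - x i)) = relPattern r x j := by
  have hinj : Function.Injective x := lensLift_injective_of_separated hδ hx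
  ext w
  simp only [ballPattern, reroot, relPattern, Finset.mem_filter, Finset.mem_erase,
    Finset.mem_image, Finset.mem_insert, Finset.mem_univ, true_and]
  constructor
  · rintro ⟨⟨hw0, u, hu, rfl⟩, hwr⟩
    obtain ⟨k, rfl⟩ : ∃ k : Fin N, x k - x i = u := by
      rcases hu with rfl | ⟨k, -, rfl⟩
      · exact ⟨i, sub_self _⟩
      · exact ⟨k, rfl⟩
    refine ⟨k, ⟨fun h => hw0 (by rw [h, sub_self]), ?_⟩, (sub_sub_sub_cancel_right _ _ _).symm⟩
    rwa [sub_sub_sub_cancel_right, ← dist_eq_norm, dist_comm] at hwr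
  · rintro ⟨k, ⟨hkj, hjk⟩, rfl⟩
    refine ⟨⟨sub_ne_zero.2 fun h => hkj (hinj h), x k - x i, ?_, sub_sub_sub_cancel_right _ _ _⟩,
      ?_⟩
    · by_cases hki : k = i
      · exact Or.inl (by rw [hki, sub_self])
      · refine Or.inr ⟨k, ⟨hki, ?_⟩, rfl⟩
        calc dist (x i) (x k) ≤ dist (x i) (x j) + dist (x j) (x k) := dist_triangle _ _ _
          _ ≤ (L - r) + r := add_le_add (by rwa [dist_eq_norm, norm_sub_rev]) hjk
          _ = L := sub_add_cancel L r
    · rw [← dist_eq_norm, dist_comm]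
      exact hjk

/-- The lens range of the `L`-pattern of `i` is the image of `k ↦ x k − x i` over the particles
`k ≠ i` with `‖x k − x i‖ ≤ L − r` (for `0 ≤ r` this already forces `dist (x i) (x k) ≤ L`).
[folklore] -/
theorem lens_relPattern {r : ℝ} (hr : 0 ≤ r) (L : ℝ) (x : Fin N → E) (i : Fin N) :
    lens r L (relPattern L x i) = Finset.image (fun k : Fin N => x k - x i)
      ((Finset.univ.erase i).filter fun k : Fin N => ‖x k - x i‖ ≤ L - r) := by
  unfold lens relPattern
  rw [Finset.filter_image, Finset.filter_filter]
  congr 1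
  ext k
  simp only [Finset.mem_filter, Finset.mem_univ, true_and, Finset.mem_erase, and_true]
  constructor
  · rintro ⟨⟨hki, -⟩, hk⟩
    exact ⟨hki, hk⟩
  · rintro ⟨hki, hk⟩
    refine ⟨⟨hki, ?_⟩, hk⟩
    rw [dist_eq_norm, norm_sub_rev]
    linarith

end Helpers

/-- **Stub `stub_lensLift` (lens lift: pattern-pointwise certificates are configuration
certificates; M−).** For `0 < δ`, `0 ≤ r ≤ L` and a `δ`-separated finite configuration `x` of `ℝ³`,
if `F S ≤ T_g(S)` for every `(δ, L)`-admissible rooted pattern `S` — `T_g` the integrand of the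
finite-level mass-transport identity, `Σ_{v ∈ lens r L S} [g(v, B_r S, B_r(reroot S v)) −
g(−v, B_r(reroot S v), B_r S)]` — then at every particle `F (relPattern L x i)` is at most the
route's unbounded-range transfer balance of the lifted rule
`Φ (v, p, q) := 1[‖v‖ ≤ L − r] · g (v, ballPattern r p, ballPattern r q)` computed from the two
`L`-patterns: `relPattern L x i` is admissible (`isRootedPattern_relPattern`), and for
`‖x_j − x_i‖ ≤ L − r` the `r`-pattern of `j` is the `L`-pattern of `i` re-rooted at `x_j − x_i` and
cut to the `r`-ball (`ballPattern_reroot_relPattern`; finite-volume mass transport / Aldous–Lyons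
lens). [folklore] -/
theorem stub_lensLift :
    ∀ (δ r L : ℝ), 0 < δ → 0 ≤ r → r ≤ L →
      ∀ (F : Finset (EuclideanSpace ℝ (Fin 3)) → ℝ) (g : EuclideanSpace ℝ (Fin 3) → Finset (EuclideanSpace ℝ (Fin 3)) → Finset (EuclideanSpace ℝ (Fin 3)) → ℝ),
        (∀ S : Finset (EuclideanSpace ℝ (Fin 3)), Literature.Probability.PointProcesses.IsRootedPattern δ L S →
          F S ≤ ∑ v ∈ Literature.Probability.PointProcesses.lens r L S,
            (g v (Literature.Probability.PointProcesses.ballPattern r S) (Literature.Probability.PointProcesses.ballPattern r (Literature.Probability.PointProcesses.reroot S v)) -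
              g (-v) (Literature.Probability.PointProcesses.ballPattern r (Literature.Probability.PointProcesses.reroot S v)) (Literature.Probability.PointProcesses.ballPattern r S))) →
        ∀ (N : ℕ) (x : Fin N → EuclideanSpace ℝ (Fin 3)), (∀ i j : Fin N, i ≠ j → δ ≤ dist (x i) (x j)) →
          ∀ i : Fin N, F (Literature.MathematicalPhysics.StatisticalMechanics.relPattern L x i) ≤ ∑ j ∈ Finset.univ.erase i,
            ((if ‖x j - x i‖ ≤ L - r then
                g (x j - x i) (Literature.Probability.PointProcesses.ballPattern r (Literature.MathematicalPhysics.StatisticalMechanics.relPattern L x i))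
                  (Literature.Probability.PointProcesses.ballPattern r (Literature.MathematicalPhysics.StatisticalMechanics.relPattern L x j)) else 0) -
             (if ‖x i - x j‖ ≤ L - r then
                g (x i - x j) (Literature.Probability.PointProcesses.ballPattern r (Literature.MathematicalPhysics.StatisticalMechanics.relPattern L x j))
                  (Literature.Probability.PointProcesses.ballPattern r (Literature.MathematicalPhysics.StatisticalMechanics.relPattern L x i)) else 0)) := by
  intro δ r L hδ hr hrL F g hF N x hx i
  have hinj : Function.Injective x := lensLift_injective_of_separated hδ hx
  refine (hF _ (isRootedPattern_relPattern L hx i)).trans_eq ?_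
  rw [lens_relPattern hr L x i,
    Finset.sum_image fun k _ l _ hkl => hinj (sub_left_injective hkl), Finset.sum_filter]
  refine Finset.sum_congr rfl fun j _ => ?_
  rw [norm_sub_rev (x i) (x j)]
  split_ifs with hj
  · rw [ballPattern_reroot_relPattern hδ hx hj, ballPattern_relPattern hrL x j, neg_sub]
  · exact (sub_self 0).symm

end Summit.AtomisticToContinuum.Crystallization.Theorems.PatternPricedCertificates

end
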